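import Literature.NumberTheory.EllipticCurves.Kobayashi2003.EtaColemanInterpolation
import Literature.NumberTheory.EllipticCurves.PAdicLFunctionNeZeroHoldsProofs
import HarnessLib

set_option linter.dupNamespace false

/-!
# (L-T) TRANSPORT lemmas for the twist-scalar law `hC` of stub 2c-T1 on crux `CccOneLawOnTypeIstarZero`
# (stmt-BirchSwinnertonDyer-19223, route `InertBadSignedBranches`, skeleton istar v15 1c7e623d6cf61178)

Def-free helper file (theorems only; `--supports stmt-BirchSwinnertonDyer-19223`), refill hand
`leafhand-bsd-inertbadsignedbran-9` g0, docket of host bsd-eis-plan g43 (eis STATUS l.8229 (2)) / pen bsd-cm-plan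
g40 (D1208): PRIORITY 1 (L-T) — «the `charSum` / `padicCharSum` value of a `ℚ(ζ_m)`-RATIONAL datum read through
`ι : ℚ(ζ_m) → ℂ` ((C5) of `Kato2004.ZetaBody`) and through `ιp : ℚ(ζ_m) → ℂ_p` ([A]
`Kobayashi2003.ColPlusInterpolation`, the currency of k-ty1 g39's named hypothesis `hC` of
`stub2cT1_of_colPlusInterpolation`) are images of ONE cyclotomic-field element».

WHAT IS HERE (kernel bookkeeping in (h1) currency — no cohomology class, no new definition, no number theory claimed):
* §1 READINGS: a Dirichlet character `θ₀` with values in `ℚ(ζ_m)` has a complex avatar `θ₀.ringHomComp ι` and a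
  `p`-adic avatar `θ₀.ringHomComp ιp`; Kato's complex character sum `EulerSystemValues.charSum` (left side of (C5)),
  Kobayashi's `p`-adic character sum `Kobayashi2003.padicCharSum` on a RATIONAL tensor `s ⊗ x` ((C4):
  `Λ(z) = 1 ⊗ x`) and Kobayashi's `p`-adic Gauss sum `padicGaussSum` (left side of `hC`) are `ι`, resp. `ιp`, of
  ONE explicit element of `ℚ(ζ_m)`; hence an identity `charSum … = ι y` read in `ℂ` transports VERBATIM to
  `padicCharSum … (s ⊗ x) = s · ιp y` in `ℂ_p` (`ι` is injective) — `padicCharSum_tmul_eq_of_charSum_eq`,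
  `sum_mul_sigma_eq_of_charSum_eq`.
* §2 LIFTING: every Dirichlet character mod `m` with values in a field `K` whose values are `k`-th roots of unity,
  `ℚ(ζ_m)` holding a primitive `k`-th root of unity, IS an avatar along any `σ : ℚ(ζ_m) → K`
  (`exists_ringHomComp_eq_of_pow_eq_one`, pattern of the tree's `DirichletCharacter.exists_ringHomComp_padicAlgCl_eq`);
  for odd `m`, `−ζ_m` is a primitive `2m`-th root of unity, so characters of order dividing `2m` lift — in
  particular the `ψ` mod `p^{n+1}` of order `2pⁿ` of `hC` / `ColPlusInterpolation` (`exists_ringHomComp_eq_of_orderOf_eq`)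
  and, by `ringHomComp_pow` / `ringHomComp_inv_apply` / `changeLevel_ringHomComp`, their companions `ψ^{pⁿ−1}`, `ψ⁻¹`
  and level changes.
* §3 THE COMPLEX SIDE PULLED BACK: `ι(ζ_m)^k = e^{2πi/m}` for some `k` prime to `m` depending on `ι` only
  (`exists_pow_eq_stdAddChar_one`); the complex Gauss sum `gaussSum (θ₀.ringHomComp ι) stdAddChar` of Birch's formula is
  `ι(Σ_a θ₀(a) ζ_m^{ka})`; Birch's formula for BOTH parities (tree theorems `ratTwistedSymbolSum_mul_plusPeriod_holds`,
  `ratMinusTwistedSymbolSum_mul_minusPeriod_mul_I`) then reads `ι(symbol sum) · period = ι(cyclotomic Gauss sum) · L(1)`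
  with both algebraic factors in `ℚ(ζ_m)` (`map_ratTwistedSymbolSum_mul_plusPeriod`,
  `map_ratMinusTwistedSymbolSum_mul_minusPeriod_mul_I`); Kato's cusp factor of (C5) on a lift is `ι` of the same
  four-term expression in `ℚ(ζ_m)` (`cuspFactor_comp_eq_map`); the `p`-adic symbol sums of `hC`'s right side are `ιp` of
  the cyclotomic ones (`ratTwistedSymbolSums_ringHomComp_padic`).
WHAT IS NOT HERE: (L-M) the value of `katoMultiplier` at `ψ(γ) − 1` / the depletion bracket `L_S/L` at `s = 1`;
(L-η) `L(f_W, χ) = L(f_V, ηχ)`; the `Δ`-norm read-off of `Λ (res ∘ levelToLayer)`; any value of `λ` or `C′`; `hC` itself.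

HONEST LABEL: helper lemmas; nothing about `hC`, stub 2c-T1, 19223, X12 or BSD is proved here; 2c-T1 NOT closed;
19223 OPEN; BSD is proved for no curve.
-/

noncomputable section

open scoped Classical TensorProduct

open Literature.NumberTheory.EllipticCurves
open Literature.NumberTheory.EllipticCurves.Kato2004.EulerSystemValues
open Literature.NumberTheory.EllipticCurves.Kobayashi2003

namespace Summit.BirchSwinnertonDyer.BirchSwinnertonDyer.Theorems.CccOneTwistScalarTransport

/-! ## §1 The two readings of a cyclotomic-valued character sum -/

section Readings

variable (p : ℕ) [Fact p.Prime] {m : ℕ} [NeZero m]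

/-- Kato's complex character sum of `x ∈ ℚ(ζ_m)` against the complex avatar `θ₀.ringHomComp ι` of a
`ℚ(ζ_m)`-valued Dirichlet character is `ι` of the cyclotomic character sum `Σ_b θ₀(b)·σ_b x`.
[cite: Kato2004Asterisque, Thm. 6.6 (1) (p. 163)] -/
theorem charSum_ringHomComp (ι : CyclotomicField m ℚ →+* ℂ)
    (θ₀ : DirichletCharacter (CyclotomicField m ℚ) m) (x : CyclotomicField m ℚ) :
    charSum m ι (θ₀.ringHomComp ι) x = ι (∑ b : (ZMod m)ˣ, θ₀ (b : ZMod m) * sigma m b x) := by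
  simp only [charSum, map_sum, map_mul, MulChar.ringHomComp_apply]

/-- Kobayashi's `p`-adic character sum of a RATIONAL tensor `s ⊗ x ∈ ℚ_p ⊗ ℚ(ζ_m)` against the `p`-adic avatar
`θ₀.ringHomComp ιp` is `s · ιp(Σ_b θ₀(b)·σ_b x)`. [cite: Kobayashi2003, Prop. 8.25 and (8.29) (p. 24)] -/
theorem padicCharSum_tmul_ringHomComp (ιp : CyclotomicField m ℚ →+* ℂ_[p])
    (θ₀ : DirichletCharacter (CyclotomicField m ℚ) m) (s : ℚ_[p]) (x : CyclotomicField m ℚ) :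
    padicCharSum p m ιp (θ₀.ringHomComp ιp) (s ⊗ₜ[ℚ] x) =
      algebraMap ℚ_[p] ℂ_[p] s * ιp (∑ b : (ZMod m)ˣ, θ₀ (b : ZMod m) * sigma m b x) := by
  simp only [padicCharSum_def, padicReadOff_tmul, MulChar.ringHomComp_apply, map_sum, map_mul,
    Finset.mul_sum]
  exact Finset.sum_congr rfl fun b _ ↦ by ring

set_option backward.isDefEq.respectTransparency false in
/-- Kobayashi's `p`-adic Gauss sum of the `p`-adic avatar is `ιp` of the cyclotomic Gauss sum
`Σ_b θ₀(b)·ζ_m^b` against the distinguished root `ζ_m = zeta m ℚ ℚ(ζ_m)`.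
[cite: Kobayashi2003, Prop. 8.26 (p. 25)] -/
theorem padicGaussSum_ringHomComp (ιp : CyclotomicField m ℚ →+* ℂ_[p])
    (θ₀ : DirichletCharacter (CyclotomicField m ℚ) m) :
    padicGaussSum p m ιp (θ₀.ringHomComp ιp) =
      ιp (∑ b : (ZMod m)ˣ, θ₀ (b : ZMod m) *
        IsCyclotomicExtension.zeta m ℚ (CyclotomicField m ℚ) ^ (b : ZMod m).val) := by
  simp only [padicGaussSum_def, map_sum, map_mul, map_pow, MulChar.ringHomComp_apply]

/-- **(L-T) TRANSPORT.** If the complex reading of the cyclotomic character sum of `x` is `ι y` for a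
cyclotomic element `y` (e.g. (C5) of `Kato2004.ZetaBody` with Birch's formula pulled back along `ι`), then the
`p`-adic reading of the rational tensor `s ⊗ x` is `s · ιp y` — `ι` is injective, so the character sum IS `y`.
[cite: Kato2004Asterisque, Thm. 6.6 (1) (p. 163), Thm. 9.7 (p. 189)] [cite: Kobayashi2003, Prop. 8.25 (p. 24)] -/
theorem padicCharSum_tmul_eq_of_charSum_eq (ι : CyclotomicField m ℚ →+* ℂ)
    (ιp : CyclotomicField m ℚ →+* ℂ_[p]) (θ₀ : DirichletCharacter (CyclotomicField m ℚ) m)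
    {x y : CyclotomicField m ℚ} (h : charSum m ι (θ₀.ringHomComp ι) x = ι y) (s : ℚ_[p]) :
    padicCharSum p m ιp (θ₀.ringHomComp ιp) (s ⊗ₜ[ℚ] x) = algebraMap ℚ_[p] ℂ_[p] s * ιp y := by
  rw [padicCharSum_tmul_ringHomComp]
  rw [charSum_ringHomComp] at h
  rw [ι.injective h]

/-- The cyclotomic character sum is determined by its complex reading: two cyclotomic elements with the same
image under `ι` are equal (injectivity of a ring map out of a field), stated for the character sum.
[cite: Kato2004Asterisque, Thm. 6.6 (1) (p. 163)] -/
theorem sum_mul_sigma_eq_of_charSum_eq (ι : CyclotomicField m ℚ →+* ℂ)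
    (θ₀ : DirichletCharacter (CyclotomicField m ℚ) m) {x y : CyclotomicField m ℚ}
    (h : charSum m ι (θ₀.ringHomComp ι) x = ι y) :
    ∑ b : (ZMod m)ˣ, θ₀ (b : ZMod m) * sigma m b x = y := by
  rw [charSum_ringHomComp] at h
  exact ι.injective h

end Readings

/-! ## §2 Lifting characters with root-of-unity values to `ℚ(ζ_m)` -/

section Lifting

variable {m : ℕ} [NeZero m] {K : Type*} [Field K]

omit [NeZero m] in
/-- **LIFTING.** A Dirichlet character mod `m` with values in a field `K`, all of whose values are `k`-th roots of
unity for some `k` such that `ℚ(ζ_m)` contains a primitive `k`-th root of unity, is the avatar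
`θ₀.ringHomComp σ` of a `ℚ(ζ_m)`-valued character `θ₀` along any ring map `σ : ℚ(ζ_m) → K` (`σ` restricts to a
bijection `μ_k(ℚ(ζ_m)) → μ_k(K)`: injective between groups of the same order `k`). Pattern of the tree's
`DirichletCharacter.exists_ringHomComp_padicAlgCl_eq`. [cite: MazurTateTeitelbaum1986Invent, §I.13] -/
theorem exists_ringHomComp_eq_of_pow_eq_one (σ : CyclotomicField m ℚ →+* K) {k : ℕ} [NeZero k]
    {ζ₀ : CyclotomicField m ℚ} (hζ₀ : IsPrimitiveRoot ζ₀ k) (θ : DirichletCharacter K m)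
    (hθ : ∀ u : (ZMod m)ˣ, θ u ^ k = 1) :
    ∃ θ₀ : DirichletCharacter (CyclotomicField m ℚ) m, θ₀.ringHomComp σ = θ := by
  classical
  have hmem : ∀ u : (ZMod m)ˣ, θ.toUnitHom u ∈ rootsOfUnity k K := fun u ↦ by
    rw [mem_rootsOfUnity, Units.ext_iff, Units.val_pow_eq_pow_val, MulChar.coe_toUnitHom, Units.val_one]
    exact hθ u
  set e : rootsOfUnity k (CyclotomicField m ℚ) →* rootsOfUnity k K := restrictRootsOfUnity σ k with he
  have heinj : Function.Injective e := by
    intro x y hxy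
    have h := congr_arg (fun z : rootsOfUnity k K ↦ ((z : Kˣ) : K)) hxy
    simp only [he, restrictRootsOfUnity_coe_apply] at h
    exact Subtype.ext (Units.ext (σ.injective h))
  have hcard : Nat.card (rootsOfUnity k (CyclotomicField m ℚ)) = Nat.card (rootsOfUnity k K) := by
    rw [hζ₀.card_rootsOfUnity, (hζ₀.map_of_injective σ.injective).card_rootsOfUnity]
  have hebij : Function.Bijective e :=
    (Nat.bijective_iff_injective_and_card e).mpr ⟨heinj, hcard⟩
  set E : rootsOfUnity k (CyclotomicField m ℚ) ≃* rootsOfUnity k K := MulEquiv.ofBijective e hebij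
    with hE
  set ψ : (ZMod m)ˣ →* (CyclotomicField m ℚ)ˣ :=
    (rootsOfUnity k (CyclotomicField m ℚ)).subtype.comp
      (E.symm.toMonoidHom.comp (θ.toUnitHom.codRestrict (rootsOfUnity k K) hmem)) with hψ
  refine ⟨MulChar.ofUnitHom ψ, ?_⟩
  ext u
  rw [MulChar.ringHomComp_apply, MulChar.ofUnitHom_coe, ← MulChar.coe_toUnitHom]
  have h1 : E (E.symm (θ.toUnitHom.codRestrict (rootsOfUnity k K) hmem u)) =
      θ.toUnitHom.codRestrict (rootsOfUnity k K) hmem u := E.apply_symm_apply _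
  have h2 := congr_arg (fun z : rootsOfUnity k K ↦ ((z : Kˣ) : K)) h1
  simp only [hE, MulEquiv.ofBijective_apply, he, restrictRootsOfUnity_coe_apply,
    MonoidHom.codRestrict_apply] at h2
  rw [hψ]
  simp only [MonoidHom.coe_comp, Function.comp_apply, Subgroup.coe_subtype,
    MulEquiv.coe_toMonoidHom]
  exact h2

set_option backward.isDefEq.respectTransparency false in
/-- For ODD `m`, `−ζ_m` is a primitive `2m`-th root of unity in `ℚ(ζ_m)` (orders `2` and `m` are coprime and
`−1`, `ζ_m` commute). [folklore] -/
theorem isPrimitiveRoot_neg_zeta_two_mul (hm : Odd m) :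
    IsPrimitiveRoot (-IsCyclotomicExtension.zeta m ℚ (CyclotomicField m ℚ)) (2 * m) := by
  have hζ := IsCyclotomicExtension.zeta_spec m ℚ (CyclotomicField m ℚ)
  have h1 : orderOf (-1 : CyclotomicField m ℚ) = 2 := by
    rw [orderOf_neg_one, if_neg]
    rw [ringChar.eq_zero]
    norm_num
  have h2 : orderOf (IsCyclotomicExtension.zeta m ℚ (CyclotomicField m ℚ)) = m := hζ.eq_orderOf.symm
  have hcop : Nat.Coprime (orderOf (-1 : CyclotomicField m ℚ))
      (orderOf (IsCyclotomicExtension.zeta m ℚ (CyclotomicField m ℚ))) := by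
    rw [h1, h2]
    exact (Nat.coprime_two_left).mpr hm
  have h3 := (Commute.all (-1 : CyclotomicField m ℚ) _).orderOf_mul_eq_mul_orderOf_of_coprime hcop
  rw [h1, h2, neg_one_mul] at h3
  rw [← h3]
  exact IsPrimitiveRoot.orderOf _

set_option backward.isDefEq.respectTransparency false in
/-- **LIFTING, odd level.** For odd `m`, every `K`-valued Dirichlet character mod `m` whose values are `2m`-th
roots of unity lifts to `ℚ(ζ_m)` along any `σ : ℚ(ζ_m) → K`. [cite: MazurTateTeitelbaum1986Invent, §I.13] -/
theorem exists_ringHomComp_eq_of_pow_two_mul_eq_one (hm : Odd m) (σ : CyclotomicField m ℚ →+* K)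
    (θ : DirichletCharacter K m) (hθ : ∀ u : (ZMod m)ˣ, θ u ^ (2 * m) = 1) :
    ∃ θ₀ : DirichletCharacter (CyclotomicField m ℚ) m, θ₀.ringHomComp σ = θ := by
  haveI : NeZero (2 * m) := ⟨mul_ne_zero two_ne_zero (NeZero.ne m)⟩
  exact exists_ringHomComp_eq_of_pow_eq_one σ (isPrimitiveRoot_neg_zeta_two_mul hm) θ hθ

/-- **LIFTING by order.** If the order of a `K`-valued Dirichlet character mod an odd `m` divides `2m`, it lifts
to `ℚ(ζ_m)` along any `σ`. [cite: MazurTateTeitelbaum1986Invent, §I.13] -/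
theorem exists_ringHomComp_eq_of_orderOf_dvd (hm : Odd m) (σ : CyclotomicField m ℚ →+* K)
    (θ : DirichletCharacter K m) (hθ : orderOf θ ∣ 2 * m) :
    ∃ θ₀ : DirichletCharacter (CyclotomicField m ℚ) m, θ₀.ringHomComp σ = θ := by
  refine exists_ringHomComp_eq_of_pow_two_mul_eq_one hm σ θ fun u ↦ ?_
  have hpow : θ ^ (2 * m) = 1 := orderOf_dvd_iff_pow_eq_one.mp hθ
  have := congr_arg (fun χ : DirichletCharacter K m ↦ χ (u : ZMod m)) hpow
  simpa only [MulChar.pow_apply_coe, MulChar.one_apply_coe] using this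

/-- **The characters of `hC` / `ColPlusInterpolation` lift.** A `K`-valued Dirichlet character `ψ` mod `p^{n+1}`
of order `2pⁿ`, `p` an odd prime, lifts to `ℚ(ζ_{p^{n+1}})` along any `σ` (`2pⁿ ∣ 2p^{n+1}`, `p^{n+1}` odd).
[cite: Kobayashi2003, (3.4)–(3.5) (p. 7) and proof of Thm. 6.3 (p. 25)] -/
theorem exists_ringHomComp_eq_of_orderOf_eq {p : ℕ} [Fact p.Prime] (hp : p ≠ 2) (n : ℕ)
    (σ : CyclotomicField (p ^ (n + 1)) ℚ →+* K) (ψ : DirichletCharacter K (p ^ (n + 1)))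
    (hψ : orderOf ψ = 2 * p ^ n) :
    ∃ ψ₀ : DirichletCharacter (CyclotomicField (p ^ (n + 1)) ℚ) (p ^ (n + 1)), ψ₀.ringHomComp σ = ψ := by
  have hodd : Odd (p ^ (n + 1)) := ((Fact.out : p.Prime).eq_two_or_odd'.resolve_left hp).pow
  refine exists_ringHomComp_eq_of_orderOf_dvd hodd σ ψ ?_
  rw [hψ]
  exact Nat.mul_dvd_mul_left 2 (pow_dvd_pow p (Nat.le_succ n))

omit [NeZero m] in
/-- Powers of a lift are lifts of powers: the `W`-currency companion `ψ^{pⁿ−1}` of `ψ` ([A], CURRENCY POINT) is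
the avatar of `ψ₀^{pⁿ−1}`. [cite: Kobayashi2003, proof of Thm. 6.3 (p. 25)] -/
theorem ringHomComp_pow (σ : CyclotomicField m ℚ →+* K) (θ₀ : DirichletCharacter (CyclotomicField m ℚ) m)
    (j : ℕ) : (θ₀ ^ j).ringHomComp σ = θ₀.ringHomComp σ ^ j := by
  induction j with
  | zero =>
    ext u
    simp
  | succ j ih =>
    ext u
    rw [pow_succ, pow_succ, MulChar.ringHomComp_mul, ih]

omit [NeZero m] in
/-- Level change commutes with taking avatars. [folklore] -/
theorem changeLevel_ringHomComp {m' : ℕ} [NeZero m'] (hmm : m ∣ m') (σ : CyclotomicField m' ℚ →+* K)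
    (θ₀ : DirichletCharacter (CyclotomicField m' ℚ) m) :
    DirichletCharacter.changeLevel hmm (θ₀.ringHomComp σ) =
      (DirichletCharacter.changeLevel hmm θ₀).ringHomComp σ := by
  ext u
  rw [MulChar.ringHomComp_apply, DirichletCharacter.changeLevel_eq_cast_of_dvd _ hmm,
    DirichletCharacter.changeLevel_eq_cast_of_dvd _ hmm, MulChar.ringHomComp_apply]

omit [NeZero m] in
/-- Inverses of lifts are lifts of inverses: `(θ₀.ringHomComp σ)⁻¹ a = σ (θ₀⁻¹ a)` — the `χ̄ = χ⁻¹` of (C5)'s cusp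
factor read on a lift. [folklore] -/
theorem ringHomComp_inv_apply (σ : CyclotomicField m ℚ →+* K)
    (θ₀ : DirichletCharacter (CyclotomicField m ℚ) m) (a : ZMod m) :
    (θ₀.ringHomComp σ)⁻¹ a = σ (θ₀⁻¹ a) := by
  rw [MulChar.inv_apply, MulChar.ringHomComp_apply, ← MulChar.inv_apply]

end Lifting

/-! ## §3 The complex side pulled back: the standard additive character, Gauss sums and Birch's formula on a lift -/

section ComplexSide

variable {m : ℕ} [NeZero m]

/-- The standard additive character of `ℤ/m` is the `a`-th power of its value at `1`. [folklore] -/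
theorem stdAddChar_apply_eq_pow (a : ZMod m) :
    ZMod.stdAddChar a = ZMod.stdAddChar (1 : ZMod m) ^ a.val := by
  conv_lhs => rw [← ZMod.natCast_zmod_val a, ← nsmul_one]
  rw [AddChar.map_nsmul_eq_pow]

/-- `e^{2πi/m}`, the value of the standard additive character at `1`, is a primitive `m`-th root of unity.
[folklore] -/
theorem isPrimitiveRoot_stdAddChar_one : IsPrimitiveRoot (ZMod.stdAddChar (1 : ZMod m)) m := by
  have h := ZMod.stdAddChar_coe (N := m) 1
  rw [Int.cast_one, Int.cast_one, mul_one] at h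
  rw [h]
  exact Complex.isPrimitiveRoot_exp m (NeZero.ne m)

set_option backward.isDefEq.respectTransparency false in
/-- **The complex embedding's exponent.** For a complex embedding `ι` of `ℚ(ζ_m)` there is `k` prime to `m` with
`ι(ζ_m)^k = e^{2πi/m}` (`ι(ζ_m)` and `e^{2πi/m}` are both primitive `m`-th roots of unity in `ℂ`); `k` depends on
`ι` only. [folklore] -/
theorem exists_pow_eq_stdAddChar_one (ι : CyclotomicField m ℚ →+* ℂ) :
    ∃ k : ℕ, k.Coprime m ∧
      ι (IsCyclotomicExtension.zeta m ℚ (CyclotomicField m ℚ)) ^ k = ZMod.stdAddChar (1 : ZMod m) := by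
  have hζ := (IsCyclotomicExtension.zeta_spec m ℚ (CyclotomicField m ℚ)).map_of_injective ι.injective
  have h1 : ZMod.stdAddChar (1 : ZMod m) ^ m = 1 := (isPrimitiveRoot_stdAddChar_one (m := m)).pow_eq_one
  obtain ⟨k, -, hk⟩ := hζ.eq_pow_of_pow_eq_one h1
  refine ⟨k, ?_, hk⟩
  have hprim : IsPrimitiveRoot (ι (IsCyclotomicExtension.zeta m ℚ (CyclotomicField m ℚ)) ^ k) m := by
    rw [hk]; exact isPrimitiveRoot_stdAddChar_one
  exact (hζ.pow_iff_coprime (Nat.pos_of_ne_zero (NeZero.ne m)) k).mp hprim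

set_option backward.isDefEq.respectTransparency false in
/-- **The complex Gauss sum of an avatar is `ι` of a cyclotomic Gauss sum.** With `ι(ζ_m)^k = e^{2πi/m}`:
`gaussSum (θ₀.ringHomComp ι) stdAddChar = ι(Σ_a θ₀(a)·ζ_m^{k·a})` — the Gauss sum of Birch's formula
`ratTwistedSymbolSum_mul_plusPeriod` read on a lift. [cite: MazurTateTeitelbaum1986Invent, §I.8 (8.6)] -/
theorem gaussSum_ringHomComp_stdAddChar (ι : CyclotomicField m ℚ →+* ℂ)
    (θ₀ : DirichletCharacter (CyclotomicField m ℚ) m) {k : ℕ}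
    (hk : ι (IsCyclotomicExtension.zeta m ℚ (CyclotomicField m ℚ)) ^ k = ZMod.stdAddChar (1 : ZMod m)) :
    gaussSum (θ₀.ringHomComp ι) (ZMod.stdAddChar (N := m)) =
      ι (∑ a : ZMod m, θ₀ a * IsCyclotomicExtension.zeta m ℚ (CyclotomicField m ℚ) ^ (k * a.val)) := by
  rw [gaussSum, map_sum]
  refine Finset.sum_congr rfl fun a _ ↦ ?_
  rw [MulChar.ringHomComp_apply, map_mul, map_pow, stdAddChar_apply_eq_pow a, ← hk, ← pow_mul]

set_option backward.isDefEq.respectTransparency false in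
/-- **Birch's formula on a lift, both sides cyclotomic.** For a rational newform `f` (`IsNewform0 f`,
`coeffField f = ⊥`), a `ℚ(ζ_m)`-valued `θ₀` whose complex avatar `θ₀.ringHomComp ι` is primitive and even, the
exponent `k` of `ι` (`ι(ζ_m)^k = e^{2πi/m}`) and any entire continuation `L` of `L(f, (θ₀.ringHomComp ι)⁻¹, s)`:
`ι(Σ_a θ₀(a)[a/m]⁺_f) · Ω⁺_f = ι(Σ_a θ₀(a) ζ_m^{k a}) · L(1)` — the tree THEOREM `ratTwistedSymbolSum_mul_plusPeriod_holds`
(Birch, MTT §I.8 (8.6)) with its two algebraic factors pulled back to `ℚ(ζ_m)` (`ratTwistedSymbolSum_ringHomComp`,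
`gaussSum_ringHomComp_stdAddChar`). So `L(1)/Ω⁺_f`, the transcendental factor of (C5), is a QUOTIENT OF IMAGES of
two explicit cyclotomic elements whenever the cyclotomic Gauss sum is non-zero.
[cite: MazurTateTeitelbaum1986Invent, §I.8 (8.6)] -/
theorem map_ratTwistedSymbolSum_mul_plusPeriod {N : ℕ} [NeZero N] {f : CuspForm (CongruenceSubgroup.Gamma0 N) 2}
    (hf : ModularForms.IsNewform0 f) (hQ : ModularForms.coeffField f = ⊥) (ι : CyclotomicField m ℚ →+* ℂ)
    (θ₀ : DirichletCharacter (CyclotomicField m ℚ) m) (hχ : DirichletCharacter.IsPrimitive (θ₀.ringHomComp ι))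
    (hχe : DirichletCharacter.Even (θ₀.ringHomComp ι)) {k : ℕ}
    (hk : ι (IsCyclotomicExtension.zeta m ℚ (CyclotomicField m ℚ)) ^ k = ZMod.stdAddChar (1 : ZMod m))
    {L : ℂ → ℂ} (hL : Differentiable ℂ L)
    (hL' : ∀ s : ℂ, 2 < s.re → L s = ModularForms.twistedLSeries f (θ₀.ringHomComp ι)⁻¹ s) :
    ι (ratTwistedSymbolSum f θ₀) * (ModularForms.plusPeriod f : ℂ) =
      ι (∑ a : ZMod m, θ₀ a * IsCyclotomicExtension.zeta m ℚ (CyclotomicField m ℚ) ^ (k * a.val)) * L 1 := by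
  have hB := ratTwistedSymbolSum_mul_plusPeriod_holds (f := f) hf hQ hχ hχe hL hL'
  rwa [ratTwistedSymbolSum_ringHomComp ι f θ₀, gaussSum_ringHomComp_stdAddChar ι θ₀ hk] at hB

omit [NeZero m] in
/-- **Kato's cusp factor on a lift is `ι` of a cyclotomic element.** For `χ̄ = ι ∘ χ̄₀` with `χ̄₀ : ℤ → ℚ(ζ_m)`
(e.g. `χ̄₀ n = θ₀⁻¹ n`, `ringHomComp_inv_apply`), `EulerSystemValues.cuspFactor f e χ̄ c d a A d'` is `ι` of the same
four-term expression written in `ℚ(ζ_m)` (the modular symbols are rational).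
[cite: Kato2004Asterisque, Thm. 6.6 (1) (p. 163), Lemma 13.10 (1) (p. 230)] -/
theorem cuspFactor_comp_eq_map {N : ℕ} (f : CuspForm (CongruenceSubgroup.Gamma0 N) 2) (ι : CyclotomicField m ℚ →+* ℂ)
    (e : Bool) (χbar₀ : ℤ → CyclotomicField m ℚ) (c d a : ℤ) (A : ℕ) (d' : ℤ) :
    cuspFactor f e (fun n ↦ ι (χbar₀ n)) c d a A d' =
      ι (let sym : ℚ → ℚ := if e then ratMinusSymbol f else ratPlusSymbol f
        ((c : CyclotomicField m ℚ) ^ 2 * (d : CyclotomicField m ℚ) ^ 2) * (sym ((a : ℚ) / A) : CyclotomicField m ℚ)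
          - ((c : CyclotomicField m ℚ) * (d : CyclotomicField m ℚ) ^ 2) * χbar₀ c *
              (sym ((a * c : ℚ) / A) : CyclotomicField m ℚ)
          - ((c : CyclotomicField m ℚ) ^ 2 * (d : CyclotomicField m ℚ)) * χbar₀ d *
              (sym ((a * d' : ℚ) / A) : CyclotomicField m ℚ)
          + ((c : CyclotomicField m ℚ) * (d : CyclotomicField m ℚ)) * χbar₀ (c * d) *
              (sym ((a * c * d' : ℚ) / A) : CyclotomicField m ℚ)) := by
  simp only [cuspFactor, map_add, map_sub, map_mul, map_pow, map_intCast, map_ratCast]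

set_option backward.isDefEq.respectTransparency false in
/-- **Birch's formula for ODD characters on a lift, both sides cyclotomic** (the `p ≡ 3 (mod 4)` parity of `hC`,
`ratMinusTwistedSymbolSum`): for a rational newform `f`, a `ℚ(ζ_m)`-valued `θ₀` whose complex avatar is primitive
and odd, the exponent `k` of `ι` and any entire continuation `L` of `L(f, (θ₀.ringHomComp ι)⁻¹, s)`:
`ι(Σ_a θ₀(a)[a/m]⁻_f) · Ω⁻_f · i = ι(Σ_a θ₀(a) ζ_m^{k a}) · L(1)` — the tree THEOREM
`ratMinusTwistedSymbolSum_mul_minusPeriod_mul_I` with its algebraic factors pulled back to `ℚ(ζ_m)`.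
[cite: MazurTateTeitelbaum1986Invent, §I.8 (8.6)] -/
theorem map_ratMinusTwistedSymbolSum_mul_minusPeriod_mul_I {N : ℕ} [NeZero N]
    {f : CuspForm (CongruenceSubgroup.Gamma0 N) 2}
    (hf : ModularForms.IsNewform0 f) (hQ : ModularForms.coeffField f = ⊥) (ι : CyclotomicField m ℚ →+* ℂ)
    (θ₀ : DirichletCharacter (CyclotomicField m ℚ) m) (hχ : DirichletCharacter.IsPrimitive (θ₀.ringHomComp ι))
    (hχo : DirichletCharacter.Odd (θ₀.ringHomComp ι)) {k : ℕ}
    (hk : ι (IsCyclotomicExtension.zeta m ℚ (CyclotomicField m ℚ)) ^ k = ZMod.stdAddChar (1 : ZMod m))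
    {L : ℂ → ℂ} (hL : Differentiable ℂ L)
    (hL' : ∀ s : ℂ, 2 < s.re → L s = ModularForms.twistedLSeries f (θ₀.ringHomComp ι)⁻¹ s) :
    ι (ratMinusTwistedSymbolSum f θ₀) * (ModularForms.minusPeriod f : ℂ) * Complex.I =
      ι (∑ a : ZMod m, θ₀ a * IsCyclotomicExtension.zeta m ℚ (CyclotomicField m ℚ) ^ (k * a.val)) * L 1 := by
  have hB := ratMinusTwistedSymbolSum_mul_minusPeriod_mul_I (f := f) hf hQ hχ hχo hL hL'
  have hr : ratMinusTwistedSymbolSum f (θ₀.ringHomComp ι) = ι (ratMinusTwistedSymbolSum f θ₀) := by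
    simp only [ratMinusTwistedSymbolSum, map_sum, map_mul, map_ratCast, MulChar.ringHomComp_apply]
  rwa [hr, gaussSum_ringHomComp_stdAddChar ι θ₀ hk] at hB

/-- The `p`-adic avatars of the two symbol sums of `hC`'s right-hand side are `ιp` of the cyclotomic symbol sums
(the `[a/m]^±_f` are rational): the tree lemma `ratTwistedSymbolSum_ringHomComp` and its minus twin, recorded at
`ℂ_p`. [cite: MazurTateTeitelbaum1986Invent, §I.8 (8.6)] -/
theorem ratTwistedSymbolSums_ringHomComp_padic (p : ℕ) [Fact p.Prime] {N : ℕ}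
    (f : CuspForm (CongruenceSubgroup.Gamma0 N) 2) (ιp : CyclotomicField m ℚ →+* ℂ_[p])
    (θ₀ : DirichletCharacter (CyclotomicField m ℚ) m) :
    ratTwistedSymbolSum f (θ₀.ringHomComp ιp) = ιp (ratTwistedSymbolSum f θ₀) ∧
      ratMinusTwistedSymbolSum f (θ₀.ringHomComp ιp) = ιp (ratMinusTwistedSymbolSum f θ₀) := by
  refine ⟨ratTwistedSymbolSum_ringHomComp ιp f θ₀, ?_⟩
  simp only [ratMinusTwistedSymbolSum, map_sum, map_mul, map_ratCast, MulChar.ringHomComp_apply]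

end ComplexSide

end Summit.BirchSwinnertonDyer.BirchSwinnertonDyer.Theorems.CccOneTwistScalarTransport

end
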